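import Literature.AnabelianGeometry.AbsoluteAnabelian.AbsTopIProp410DensityProofs
import Literature.AnabelianGeometry.SemiGraphs.TemperedDeltaCompletion
import HarnessLib

/-!
# [AbsTopI] Prop 4.10 (iii), row iii.L03: the finite-level half (R1) of the density residue is a
# THEOREM at genuine data; the assembly with the iii.L03 inputs reduced (proof-only)

S. Mochizuki, *Topics in Absolute Anabelian Geometry I: Generalities* [AbsTopI] (J. Math. Sci.
Univ. Tokyo 19 (2012)), Prop 4.10 (iii) p. 60, Def 4.2 (i)(c) p. 48 / (iii)(c) p. 50 ("a surjection
`Π_j ↠ Π_{j+1}`" of profinite groups); manuscript pagination, lit key `paper:url-11ac98ba15fc`, read on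
the page; and S. Mochizuki, *Semi-graphs of anabelioids* [SemiAnbd] §6 p. 69 (`Δ_X := (Δ^temp_X)^∧`,
exactness of `1 → Δ_X → Π_X → G_K`).  Companion of `AbsTopIProp410DensityProofs.lean` (row iii.L03 of
`HOME/plan/L4/SUBDAG-AbsTopI-Prop410.md`): there, density of `Δ^tp_X → Δ^tp_Y` was reduced, under
(i) for `Y`, to (R1) "`Δ^tp_Y = f(Δ^tp_X) · H′`" ∧ (R2) "`H′ = f(f⁻¹H′) · H′^{co-fr}`" for the Y-indices
`H′`.  Here:

* `augHat_fHat` — `f̂` is compatible with the profinite augmentations (density of `Π^tp_X` in `Π_X`,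
  `G_{ℚ_p}` Hausdorff); `map_deltaHat_le` — `f̂(Δ_X) ⊆ Δ_Y`; `deltaHat_le_map_fHat` — `Δ_Y ⊆ f̂(Δ_X)`
  from exactness `Ker(Π_X → G_{ℚ_p}) ⊆ Δ_X` (a theorem under abc-iut-L3's `GroupLevelData`,
  `TemperedCurve.ker_augHat_eq_deltaHat`) and the field `fHat_surjective` (Def 4.2 (iii)(c));
* `le_sup_of_deltaHat` — (R1) from `Δ_Y ⊆ f̂(Δ_X)` and `IsProfiniteCompletion Y.deltaToHat` (L3's
  `isProfiniteCompletion_deltaToHat`); `le_sup_of_groupLevelData` — (R1) under the `GroupLevelData`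
  bundles of `X` and `Y` ("`Π^temp` tempered, Galois-countable", ruling η′);
* `denseRange_fDelta_of_graphSurj` — row iii.L03 (density) at genuine data from (R2) ALONE;
  `prop410iiiAt_of_rows''` — gen 4's assembly `prop410iiiAt_of_rows'` with `hrange` discharged to the
  same base field `X.K = Y.K` and `hdense` to (R2).

Inputs are hypotheses stated in the signatures (no new named facts; FACT-LIST untouched).
HONEST FRAMING: refereed prerequisite papers; nothing here bears on [IUTchIII] Cor 3.12; typed ≠ proved.
-/

noncomputable section

open _root_.Topology Filter

namespace Literature.AnabelianGeometry.AbsoluteAnabelian.AbsTopI.Prop410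

open Literature.AnabelianGeometry.SemiGraphs
open Literature.AnabelianGeometry.AbsoluteAnabelian.AbsTopI

variable {p : ℕ} [Fact p.Prime]

/-! ### (R1) is a theorem at genuine data: surjectivity of `f̂` on `Δ̂` and the completion `Δ^tp_Y → Δ_Y` -/

namespace DeCuspidalization

variable {X Y : TemperedCurve p} (E : DeCuspidalization X Y)

/-- `f̂` is compatible with the profinite augmentations: `augHat_Y ∘ f̂ = augHat_X` (they agree on
the dense image of `Π^tp_X`, by `aug_comp`, and `G_{ℚ_p}` is Hausdorff).
[cite: MochizukiAbsTopI2012, Def 4.2 (i) p.48] -/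
theorem augHat_fHat (x : X.PiHat) : Y.augHat (E.fHat x) = X.augHat x := by
  haveI : T2Space (GQp p) := krullTopology_t2
  have hd : _root_.Dense (Set.range X.toHat) := X.isProfiniteCompletion_toHat.denseRange
  have heq : (fun z => Y.augHat (E.fHat z)) = fun z => X.augHat z := by
    refine Continuous.ext_on hd (Y.augHat.continuous.comp E.fHat.continuous) X.augHat.continuous ?_
    rintro _ ⟨g, rfl⟩
    change Y.augHat (E.fHat (X.toHat g)) = X.augHat (X.toHat g)
    rw [← E.toHat_comp g, Y.augHat_comp, X.augHat_comp, E.aug_comp]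
  exact congrFun heq x

/-- `f̂(Δ_X) ⊆ Δ_Y` (continuity of `f̂`, `toHat_Y ∘ f = f̂ ∘ toHat_X`, `f(Δ^tp_X) ⊆ Δ^tp_Y`).
[cite: MochizukiAbsTopI2012, Prop 4.10 (iii) p.60] -/
theorem map_deltaHat_le : X.DeltaHat.map E.fHat.toMonoidHom ≤ Y.DeltaHat := by
  rintro _ ⟨x, hx, rfl⟩
  -- `x ∈ closure toHat_X(Δ^tp_X)` and `f̂` is continuous
  have hx' : x ∈ closure ((X.DeltaTemp.map X.toHat.toMonoidHom : Subgroup X.PiHat) : Set X.PiHat) := by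
    rw [← Subgroup.topologicalClosure_coe]
    exact hx
  have himg : E.fHat x ∈
      closure (E.fHat '' ((X.DeltaTemp.map X.toHat.toMonoidHom : Subgroup X.PiHat) : Set X.PiHat)) :=
    image_closure_subset_closure_image E.fHat.continuous ⟨x, hx', rfl⟩
  have hsub : E.fHat '' ((X.DeltaTemp.map X.toHat.toMonoidHom : Subgroup X.PiHat) : Set X.PiHat) ⊆
      ((Y.DeltaTemp.map Y.toHat.toMonoidHom : Subgroup Y.PiHat) : Set Y.PiHat) := by
    rintro _ ⟨_, ⟨d, hd, rfl⟩, rfl⟩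
    refine ⟨E.f d, E.map_mem_deltaTemp hd, ?_⟩
    change Y.toHat (E.f d) = E.fHat (X.toHat d)
    exact E.toHat_comp d
  change E.fHat x ∈ (Y.DeltaTemp.map Y.toHat.toMonoidHom).topologicalClosure
  rw [← SetLike.mem_coe, Subgroup.topologicalClosure_coe]
  exact closure_mono hsub himg

/-- **`Δ_Y ⊆ f̂(Δ_X)`** from exactness of the completed sequence for `X` (`Ker(Π_X → G_{ℚ_p}) ⊆ Δ_X`;
a theorem under L3's `GroupLevelData`, `TemperedCurve.ker_augHat_eq_deltaHat`): a preimage under the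
surjection `f̂` of an element of `Δ_Y ⊆ Ker(augHat_Y)` lies in `Ker(augHat_X)`.
[cite: MochizukiAbsTopI2012, Def 4.2 (iii) p.50] -/
theorem deltaHat_le_map_fHat (hX : X.augHat.toMonoidHom.ker ≤ X.DeltaHat) :
    Y.DeltaHat ≤ X.DeltaHat.map E.fHat.toMonoidHom := by
  intro y hy
  obtain ⟨x, rfl⟩ := E.fHat_surjective y
  have hyk : Y.augHat (E.fHat x) = 1 :=
    (MonoidHom.mem_ker).mp (EtaleTheta.SettingCompletion.deltaHat_le_ker_augHat Y hy)
  have hx : x ∈ X.augHat.toMonoidHom.ker := by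
    rw [MonoidHom.mem_ker]
    change X.augHat x = 1
    rw [← E.augHat_fHat x]
    exact hyk
  exact ⟨x, hX hx, rfl⟩

/-- **(R1) from profinite data**: if `Δ_Y ⊆ f̂(Δ_X)` and `Δ^tp_Y → Δ_Y` is a profinite completion
(`IsProfiniteCompletion Y.deltaToHat`), then `Δ^tp_Y = f(Δ^tp_X) · H′` for every Y-index `H′`:
`H′ ∩ Δ^tp_Y` is cut out by an open normal `V ⊴ Δ_Y`; a preimage `x̂ ∈ Δ_X` of `toHat_Y(y)` is
approximated inside the open `f̂⁻¹(toHat_Y(y) · V)` by some `toHat_X(d)`, `d ∈ Δ^tp_X`, and then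
`y⁻¹ f(d) ∈ H′`. [cite: MochizukiAbsTopI2012, Prop 4.10 (iii) p.60] -/
theorem le_sup_of_deltaHat (hΔY : IsProfiniteCompletion Y.deltaToHat)
    (hhat : Y.DeltaHat ≤ X.DeltaHat.map E.fHat.toMonoidHom) (H' : CharOpenSubgroup Y.DeltaTemp) :
    Y.DeltaTemp ≤ X.DeltaTemp.map E.f.toMonoidHom ⊔ H'.toSubgroup := by
  intro y hy
  haveI : Y.DeltaTemp.Normal := by
    unfold TemperedCurve.DeltaTemp
    infer_instance
  haveI : H'.toSubgroup.Normal := H'.normal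
  -- `H′ ∩ Δ^tp_Y` as an open normal subgroup of finite index of `Δ^tp_Y`, cut out by `V ⊴ Δ_Y`
  let U : OpenNormalSubgroup Y.DeltaTemp :=
    { toSubgroup := H'.toSubgroup.subgroupOf Y.DeltaTemp
      isOpen' := H'.isOpen }
  obtain ⟨V, hV⟩ := hΔY.comap_surjective U H'.finiteIndex
  -- `f̂` restricted to `Δ_X → Δ_Y`
  let φ : X.DeltaHat → Y.DeltaHat := fun z => ⟨E.fHat z, E.map_deltaHat_le ⟨z, z.2, rfl⟩⟩
  have hφ : Continuous φ := (E.fHat.continuous.comp continuous_subtype_val).subtype_mk _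
  -- a preimage `x̂ ∈ Δ_X` of `toHat_Y y`
  obtain ⟨xh, hxh, hxy⟩ := hhat (Y.deltaToHat ⟨y, hy⟩).2
  have hφx : φ ⟨xh, hxh⟩ = Y.deltaToHat ⟨y, hy⟩ := Subtype.ext hxy
  -- the open coset `δ_Y(y) · V` and its open preimage under `φ`, which contains `x̂`
  have hcoset : IsOpen ((fun w : Y.DeltaHat => Y.deltaToHat ⟨y, hy⟩ * w) '' (V : Set Y.DeltaHat)) :=
    (Homeomorph.mulLeft (Y.deltaToHat ⟨y, hy⟩)).isOpenMap _ V.isOpen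
  have hO : IsOpen (φ ⁻¹' ((fun w : Y.DeltaHat => Y.deltaToHat ⟨y, hy⟩ * w) '' (V : Set Y.DeltaHat))) :=
    hcoset.preimage hφ
  have hne : (φ ⁻¹' ((fun w : Y.DeltaHat => Y.deltaToHat ⟨y, hy⟩ * w) ''
      (V : Set Y.DeltaHat))).Nonempty :=
    ⟨⟨xh, hxh⟩, ⟨1, V.one_mem, by
      show Y.deltaToHat ⟨y, hy⟩ * 1 = φ ⟨xh, hxh⟩
      rw [mul_one, hφx]⟩⟩
  -- density of `Δ^tp_X` in `Δ_X`
  obtain ⟨d, hd⟩ := X.denseRange_deltaToHat.exists_mem_open hO hne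
  obtain ⟨v, hv, hvd⟩ := hd
  -- `v = δ_Y(y)⁻¹ · φ(δ_X d) = δ_Y(y⁻¹ · f d)`
  have hφd : φ (X.deltaToHat d) = Y.deltaToHat (E.fDelta d) := by
    apply Subtype.ext
    change E.fHat (X.toHat (d : X.PiTemp)) = Y.toHat (E.f (d : X.PiTemp))
    exact (E.toHat_comp (d : X.PiTemp)).symm
  have hv' : v = Y.deltaToHat (⟨y, hy⟩⁻¹ * E.fDelta d) := by
    rw [map_mul, map_inv, ← hφd, ← hvd, inv_mul_cancel_left]
  have hmem : (⟨y, hy⟩⁻¹ * E.fDelta d : Y.DeltaTemp) ∈ U.toSubgroup := by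
    rw [hV, Subgroup.mem_comap]
    change Y.deltaToHat (⟨y, hy⟩⁻¹ * E.fDelta d) ∈ V.toSubgroup
    rw [← hv']
    exact hv
  have hmem' : y⁻¹ * E.f (d : X.PiTemp) ∈ H'.toSubgroup := Subgroup.mem_subgroupOf.mp hmem
  -- `y = f(d) · (y⁻¹ f d)⁻¹`
  have hy' : y = E.f (d : X.PiTemp) * (y⁻¹ * E.f (d : X.PiTemp))⁻¹ := by
    rw [mul_inv_rev, inv_inv, mul_inv_cancel_left]
  rw [hy']
  exact Subgroup.mul_mem_sup ⟨(d : X.PiTemp), d.2, rfl⟩ (Subgroup.inv_mem _ hmem')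

/-- **(R1) at genuine data**: under L3's parameter bundles `GroupLevelData` for `X` and `Y`
("`Π^temp` tempered, Galois-countable", ruling η′ — they yield `Ker(Π_X → G) = Δ_X` and
`IsProfiniteCompletion Y.deltaToHat`), `Δ^tp_Y = f(Δ^tp_X) · H′` for every Y-index `H′`.
[cite: MochizukiAbsTopI2012, Prop 4.10 (iii) p.60] -/
theorem le_sup_of_groupLevelData (dX : X.GroupLevelData) (dY : Y.GroupLevelData)
    (H' : CharOpenSubgroup Y.DeltaTemp) :
    Y.DeltaTemp ≤ X.DeltaTemp.map E.f.toMonoidHom ⊔ H'.toSubgroup :=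
  E.le_sup_of_deltaHat (Y.isProfiniteCompletion_deltaToHat dY)
    (E.deltaHat_le_map_fHat (X.ker_augHat_eq_deltaHat dX).le) H'

end DeCuspidalization

/-- **Row iii.L03 (density) at genuine data from the graph-level residue (R2) alone**: (i) for `Y`,
L3's `GroupLevelData` bundles, and "`H′ = f(f⁻¹H′) · H′^{co-fr}` for every Y-index `H′`" ⟹
`Δ^tp_X → Δ^tp_Y` is dense. [cite: MochizukiAbsTopI2012, Prop 4.10 (iii) p.60] -/
theorem denseRange_fDelta_of_graphSurj {X Y : TemperedCurve p} (E : DeCuspidalization X Y)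
    (hY : SelfCompletionAt Y) (dX : X.GroupLevelData) (dY : Y.GroupLevelData)
    (hR2 : ∀ H' : CharOpenSubgroup Y.DeltaTemp,
      H'.toSubgroup ≤ (H'.toSubgroup.comap E.f.toMonoidHom).map E.f.toMonoidHom ⊔
        cofreeCore H'.toSubgroup) :
    DenseRange E.fDelta :=
  denseRange_fDelta_of_le_sup_cofreeCore E hY fun H' =>
    (le_sup_cofreeCore_iff E H').mpr ⟨E.le_sup_of_groupLevelData dX dY H', hR2 H'⟩

/-- **The assembly with the iii.L03 inputs reduced**: Prop 4.10 (iii) at the construction from (i)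
for `Y`, the two cofinalities, the SAME BASE FIELD, the graph-level residue (R2), L3's
`GroupLevelData` bundles, §0 p. 8's minimal-co-free hypothesis for the Y-indices, and openness of the
descended maps (`prop410iiiAt_of_rows'` with `hrange`, `hdense` discharged to these).
[cite: MochizukiAbsTopI2012, Prop 4.10 (iii) p.60] -/
theorem prop410iiiAt_of_rows'' {X Y : TemperedCurve p} (E : DeCuspidalization X Y)
    (hY : SelfCompletionAt Y) (hcof : CoFreeCofinalImAlong E) (hK : X.K = Y.K)
    (dX : X.GroupLevelData) (dY : Y.GroupLevelData)
    (hR2 : ∀ H' : CharOpenSubgroup Y.DeltaTemp,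
      H'.toSubgroup ≤ (H'.toSubgroup.comap E.f.toMonoidHom).map E.f.toMonoidHom ⊔
        cofreeCore H'.toSubgroup)
    (hmin : ∀ H' : CharOpenSubgroup Y.DeltaTemp, ∃ M, IsMinimalCofreeIn H'.toSubgroup M)
    (hopen : ∀ H : CharOpenSubgroup X.DeltaTemp,
      IsOpenMap (fbar (ρX := E.fHat.comp X.toHat)
        (ρY := (ContinuousMonoidHom.id Y.PiHat).comp Y.toHat) (ΔX := X.DeltaTemp) (f := E.f)
        E.compat H)) :
    Prop410iiiAt E :=
  prop410iiiAt_of_rows' E hY hcof (exists_aug_eq_of_K_eq hK)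
    (denseRange_fDelta_of_graphSurj E hY dX dY hR2) hmin hopen

end Literature.AnabelianGeometry.AbsoluteAnabelian.AbsTopI.Prop410

end
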